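import Literature.MathematicalPhysics.QuantumLattice.HeisenbergOrderNeelDiagonalSumRule
import HarnessLib

/-!
# Kennedy–Lieb–Shastry with an arbitrary correlation dictionary: the general-kernel energy-free
# bound for the square-lattice antiferromagnet, uniformly typed in the side `L`

HONEST FRAMING: ladder R1–R4 with certified numbers; no claim on H/H₀.

Topic `MathematicalPhysics/QuantumLattice` (family `hubbard`, HubbardLadder R2 line "what is proved
rigorously today for the spin-½ square-lattice antiferromagnet"). Sibling and generalisation of
`HeisenbergOrderNeelDiagonalSumRule.lean` (the one-offset kernel `a cos q₁ cos q₂ + b(cos q₁ + cos q₂)/2 + t`,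
devices D33/D35 of the HubbardLadder cell). No named fact is introduced; every declaration is a
definition with a body or a proved theorem.

THE DICTIONARY SUM RULE. On the torus `Λ = (ℤ/Lℤ)²` character orthogonality gives, for every shift
`z ∈ Λ`, `Σ_q ĝ_q cos(p_q·z) = |Λ| c(z)` with `c(z) = Re ω(S³_0 S³_z)` (`sum_heisStructureFactor_mul_cos_torusPhase`,
`sum_heisGroundCorr_shift`). Hence for an arbitrary real DICTIONARY `κ : Λ → ℝ` of shift weights and
real `b, t`, the kernel
  `K(q) := Σ_z κ(z) cos(p_q·z) + b (cos q₁ + cos q₂)/2 + t`        (`klsKernel`)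
satisfies `|Λ|⁻¹ Σ_q K(q) ĝ_q = Φ_κ + b ε + t S(S+1)/3`, `Φ_κ := Σ_z κ(z) c(z)` (`klsKernelCorr`), by the
total sum rule (2) and the energy sum rule (3) of Kennedy–Lieb–Shastry, J. Stat. Phys. **53** (1988).

THE BOUND. Splitting off `q = Q = (π, π)` and using the `T = 0` infrared bound (1)
(`heis_infraredBound`: `0 ≤ ĝ_q`, `ĝ_q² E_{q-Q} ≤ (-ε/2) E_q` for `q ≠ Q`) termwise on `{-K(q)}₊`:
* `kls_heis_kernelSumRule` — `K(Q) |Λ|⁻¹ ĝ_Q - (-ε/2)^{1/2} 𝓦_K(L) ≤ Φ_κ + b ε + t S(S+1)/3`, with the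
  punctured Riemann sum `𝓦_K(L) := L⁻² Σ_{q ≠ Q} {-K(q)}₊ (E_q/E_{q-Q})^{1/2}` (`klsKernelRiemannSum`);
* `kls_heis_kernelSumRule_drop` — if `K(Q) ≥ 0`: `b(-ε) - t S(S+1)/3 - (-ε/2)^{1/2} 𝓦_K(L) ≤ Φ_κ`;
* `kls_heis_kernelCorr_lower_energyFree` — for `b > 0`, minimising over the unknown `-ε ≥ 0`
  (arithmetic–geometric mean): `-t S(S+1)/3 - 𝓦_K(L)²/(8b) ≤ Φ_κ`;
* `heis_neelParameter_le_of_kernel` — the retained form read as an upper bound on `|Λ|⁻¹ ĝ_Q` when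
  `K(Q) > 0`.
All four hold on every square torus of even side `2k ≥ 4`, for every spin `n/2` and every `(κ, b, t)`.
`K(Q) = Σ_z κ(z) (-1)^{|z|} - b + t` (`klsKernel_neelIndex`).

USE. This is the analytic core of "dictionary infrared LPs" (HubbardLadder devices D33/D34/D35): an LP
chooses `κ` (supported in a window of shifts), `b`, `t`; each resulting inequality is linear in the
window correlations `c(z)` and in `ε` (or energy-free), and may be combined with reflection-positivity
Gram inequalities (`heis_rpGramZ_nonneg`, `heis_rpHankelBlock_nonneg`); the only numerical input left
is an upper bound on the explicit finite sum `𝓦_K(L)` (for an `L`-uniform statement: a trigonometric-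
polynomial majorant of frequency `< L`, whose lattice average is its constant coefficient — the method of
`Summits/HubbardSuperconductivity/HubbardLadder/NeelDiagonalCorrelationUniform.lean`). Here `𝓦_K(L)` stays
symbolic.
[cite: KLS1988JSP, eqs. (1)-(3), (6)-(9), p. 1021, p. 1023] [cite: DLS1978, Theorem 4.2]
-/

noncomputable section

open Matrix Finset Literature.Probability.LatticeModels
open Literature.MathematicalPhysics.QuantumLattice

namespace Literature.MathematicalPhysics.QuantumLattice

/-! ### The dictionary kernel, its correlation functional and its punctured Riemann sum -/

/-- **The dictionary kernel** `K(q) = Σ_z κ(z) cos(p_q·z) + b (cos q₁ + cos q₂)/2 + t` on the square dual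
torus, for an arbitrary real weight `κ` on shifts. [Kennedy–Lieb–Shastry 1988, eqs. (2)–(3), (6)–(9)
(method)] [folklore] -/
def klsKernel (L : ℕ) [NeZero L] (κ : TorusSite 2 L → ℝ) (b t : ℝ) (q : TorusSite 2 L) : ℝ :=
  ∑ z : TorusSite 2 L, κ z * Real.cos (torusPhase L q z) + b * (torusCosSum L q / 2) + t

/-- **The correlation functional of the dictionary**, `Φ_κ = Σ_z κ(z) c(z)`, `c(z) = Re ω(S³_0 S³_z)` in the
ground state of the spin-`n/2` antiferromagnet. [Kennedy–Lieb–Shastry 1988, p. 1021] [folklore] -/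
def klsKernelCorr (L : ℕ) [NeZero L] (n : ℕ) (κ : TorusSite 2 L → ℝ) : ℝ :=
  ∑ z : TorusSite 2 L, κ z * heisGroundCorr 0 L n 0 z

/-- **The punctured Riemann sum of the dictionary bound**,
`𝓦_K(L) = L⁻² Σ_{q ≠ Q} {-K(q)}₊ (E_q/E_{q-Q})^{1/2}` (`E_q = Σᵢ (1 - cos qᵢ)`, `Q = (π, π)`).
[Kennedy–Lieb–Shastry 1988, eqs. (4), (6)–(9)] [folklore] -/
def klsKernelRiemannSum (L : ℕ) [NeZero L] (κ : TorusSite 2 L → ℝ) (b t : ℝ) : ℝ :=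
  (∑ q ∈ (univ : Finset (TorusSite 2 L)).erase (neelIndex L),
      max (-klsKernel L κ b t q) 0 *
        Real.sqrt (dispersion (latticeMomentum L q) /
          dispersion (latticeMomentum L (q - neelIndex L)))) / (L : ℝ) ^ 2

/-- `𝓦_K(L) ≥ 0`. [Kennedy–Lieb–Shastry 1988, eqs. (4), (6)–(9)] [cite: KLS1988JSP, eqs. (6)-(9)] -/
theorem klsKernelRiemannSum_nonneg (L : ℕ) [NeZero L] (κ : TorusSite 2 L → ℝ) (b t : ℝ) :
    0 ≤ klsKernelRiemannSum L κ b t := by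
  unfold klsKernelRiemannSum
  refine div_nonneg (sum_nonneg fun q _ => mul_nonneg (le_max_right _ _) (Real.sqrt_nonneg _)) ?_
  positivity

/-- `K(Q) = Σ_z κ(z) (-1)^{|z|} - b + t` (`cos(Q·z) = (-1)^{Σᵢ zᵢ}`, `cos Qᵢ = -1`).
[Kennedy–Lieb–Shastry 1988, eqs. (6)–(9)] [cite: KLS1988JSP, eqs. (6)-(9)] -/
theorem klsKernel_neelIndex (k : ℕ) [NeZero (2 * k)] (κ : TorusSite 2 (2 * k) → ℝ) (b t : ℝ) :
    klsKernel (2 * k) κ b t (neelIndex (2 * k)) =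
      ∑ z : TorusSite 2 (2 * k), κ z * (-1 : ℝ) ^ (∑ i, (z i).val) - b + t := by
  unfold klsKernel
  simp_rw [cos_torusPhase_neelIndex k]
  rw [torusCosSum_neelIndex k]
  push_cast
  ring

/-! ### The dictionary sum rule (Fourier side) -/

/-- **The dictionary sum rule**: `Σ_q ĝ_q (Σ_z κ(z) cos(p_q·z)) = L² Φ_κ` (character orthogonality, shift by
shift). [Kennedy–Lieb–Shastry 1988, eqs. (2)–(3), p. 1021 (method)] [cite: KLS1988JSP, eqs. (2)-(3)] -/
theorem sum_heisStructureFactor_mul_dictionary (L : ℕ) [NeZero L] (n : ℕ) (κ : TorusSite 2 L → ℝ) :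
    ∑ q : TorusSite 2 L, heisStructureFactor 0 L n q *
        (∑ z : TorusSite 2 L, κ z * Real.cos (torusPhase L q z)) =
      (L : ℝ) ^ 2 * klsKernelCorr L n κ := by
  unfold klsKernelCorr
  calc ∑ q : TorusSite 2 L, heisStructureFactor 0 L n q *
        (∑ z : TorusSite 2 L, κ z * Real.cos (torusPhase L q z))
      = ∑ z : TorusSite 2 L, κ z *
          ∑ q : TorusSite 2 L, heisStructureFactor 0 L n q * Real.cos (torusPhase L q z) := by
        simp_rw [mul_sum]
        rw [sum_comm]
        refine sum_congr rfl fun z _ => sum_congr rfl fun q _ => ?_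
        ring
    _ = ∑ z : TorusSite 2 L, κ z * ((L : ℝ) ^ 2 * heisGroundCorr 0 L n 0 z) := by
        refine sum_congr rfl fun z _ => ?_
        rw [sum_heisStructureFactor_mul_cos_torusPhase, sum_heisGroundCorr_shift]
    _ = (L : ℝ) ^ 2 * ∑ z : TorusSite 2 L, κ z * heisGroundCorr 0 L n 0 z := by
        rw [mul_sum]
        refine sum_congr rfl fun z _ => ?_
        ring

/-! ### The general-kernel bound -/

/-- **The dictionary Kennedy–Lieb–Shastry bound in finite volume, Néel term retained.** For the
spin-`n/2` antiferromagnet on the square torus of even side `2k ≥ 4`, every dictionary `κ` and all real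
`b, t`: `K(Q) |Λ|⁻¹ ĝ_Q - (-ε/2)^{1/2} 𝓦_K(L) ≤ Φ_κ + b ε + t S(S+1)/3`.
Proof: the dictionary sum rule `+ b`·(3) `+ t`·(2) is
`|Λ|(Φ_κ + bε + t S(S+1)/3) = K(Q) ĝ_Q + Σ_{q ≠ Q} K(q) ĝ_q`, and each `q ≠ Q` term is
`≥ -{-K(q)}₊ (-ε/2)^{1/2}(E_q/E_{q-Q})^{1/2}` by the infrared bound (1). [Kennedy–Lieb–Shastry 1988,
eqs. (1)–(3), (6)–(9)] [cite: KLS1988JSP, eqs. (6)-(9)] -/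
theorem kls_heis_kernelSumRule (n k : ℕ) (hk : 2 ≤ k) [NeZero (2 * k)]
    (κ : TorusSite 2 (2 * k) → ℝ) (b t : ℝ) :
    klsKernel (2 * k) κ b t (neelIndex (2 * k)) *
        (heisStructureFactor 0 (2 * k) n (neelIndex (2 * k) : TorusSite 2 (2 * k)) /
          ((2 * k : ℕ) : ℝ) ^ 2) -
        Real.sqrt (-heisBondCorr (d := 2) 0 (2 * k) n / 2) * klsKernelRiemannSum (2 * k) κ b t ≤
      klsKernelCorr (2 * k) n κ + b * heisBondCorr (d := 2) 0 (2 * k) n +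
        t * ((n : ℝ) / 2 * ((n : ℝ) / 2 + 1) / 3) := by
  have hd : 1 ≤ 2 := by norm_num
  have h2k : (0 : ℝ) < ((2 * k : ℕ) : ℝ) := by exact_mod_cast (show 0 < 2 * k by omega)
  have hL : (0 : ℝ) < ((2 * k : ℕ) : ℝ) ^ 2 := pow_pos h2k 2
  set Q : TorusSite 2 (2 * k) := neelIndex (2 * k) with hQ
  set ε := heisBondCorr (d := 2) 0 (2 * k) n with hε
  set s := -ε / 2 with hs_def
  set c := (n : ℝ) / 2 * ((n : ℝ) / 2 + 1) / 3 with hc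
  set Φ := klsKernelCorr (2 * k) n κ with hΦ
  set g : TorusSite 2 (2 * k) → ℝ := fun q => heisStructureFactor 0 (2 * k) n q with hg
  set osc : TorusSite 2 (2 * k) → ℝ :=
    fun q => ∑ z : TorusSite 2 (2 * k), κ z * Real.cos (torusPhase (2 * k) q z) with hosc
  -- `s ≥ 0` from the Néel bound
  have hN := heisBondCorr_le (d := 2) hd n k hk
  have hs : 0 ≤ s := by
    rw [hs_def]
    have : 0 ≤ ((n : ℝ) / 2) ^ 2 / 3 := by positivity
    linarith
  -- (3): `ε |Λ| = -ĝ_Q + Σ_{q ≠ Q} ĝ_q (cos q₁ + cos q₂)/2`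
  have hE : ε * ((2 * k : ℕ) : ℝ) ^ 2 =
      -g Q + ∑ q ∈ (univ : Finset (TorusSite 2 (2 * k))).erase Q,
        g q * (torusCosSum (2 * k) q / 2) := by
    have h := heis_sumRule_split (d := 2) hd 0 k n
    rw [← hε, ← hQ] at h
    simpa only [hg, Nat.cast_ofNat] using h
  -- (2): `|Λ| S(S+1)/3 = ĝ_Q + Σ_{q ≠ Q} ĝ_q`
  have hT : ((2 * k : ℕ) : ℝ) ^ 2 * c =
      g Q + ∑ q ∈ (univ : Finset (TorusSite 2 (2 * k))).erase Q, g q := by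
    rw [hc, ← heis_structureFactor_totalSumRule (2 * k) n, ← add_sum_erase _ _ (mem_univ Q)]
  -- dictionary: `|Λ| Φ = ĝ_Q osc(Q) + Σ_{q ≠ Q} ĝ_q osc(q)`
  have hD : ((2 * k : ℕ) : ℝ) ^ 2 * Φ =
      g Q * osc Q + ∑ q ∈ (univ : Finset (TorusSite 2 (2 * k))).erase Q, g q * osc q := by
    rw [hΦ, ← sum_heisStructureFactor_mul_dictionary (2 * k) n κ,
      ← add_sum_erase _ _ (mem_univ Q)]
  -- the combination dictionary + b·(3) + t·(2)
  have hK : ∑ q ∈ (univ : Finset (TorusSite 2 (2 * k))).erase Q, g q * klsKernel (2 * k) κ b t q =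
      ∑ q ∈ (univ : Finset (TorusSite 2 (2 * k))).erase Q, g q * osc q +
        b * ∑ q ∈ (univ : Finset (TorusSite 2 (2 * k))).erase Q,
          g q * (torusCosSum (2 * k) q / 2) +
        t * ∑ q ∈ (univ : Finset (TorusSite 2 (2 * k))).erase Q, g q := by
    rw [mul_sum, mul_sum, ← sum_add_distrib, ← sum_add_distrib]
    refine sum_congr rfl fun q _ => ?_
    rw [klsKernel]
    ring
  have hKQ : klsKernel (2 * k) κ b t Q = osc Q - b + t := by
    rw [klsKernel, hQ, torusCosSum_neelIndex k]
    push_cast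
    ring
  have hcomb : ((2 * k : ℕ) : ℝ) ^ 2 * (Φ + b * ε + t * c) =
      klsKernel (2 * k) κ b t Q * g Q +
        ∑ q ∈ (univ : Finset (TorusSite 2 (2 * k))).erase Q, g q * klsKernel (2 * k) κ b t q := by
    rw [hK, hKQ]
    linear_combination hD + b * hE + t * hT
  -- termwise infrared bound on the punctured sum
  have hterm : ∀ q ∈ (univ : Finset (TorusSite 2 (2 * k))).erase Q,
      -(Real.sqrt s * (max (-klsKernel (2 * k) κ b t q) 0 *
          Real.sqrt (dispersion (latticeMomentum (2 * k) q) /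
            dispersion (latticeMomentum (2 * k) (q - Q))))) ≤
        g q * klsKernel (2 * k) κ b t q := by
    intro q hq
    have hqQ : q ≠ Q := (mem_erase.1 hq).1
    obtain ⟨hgq, hAq⟩ := heis_infraredBound (d := 2) (by norm_num) n k hk q hqQ
    have hE' : 0 < dispersion (latticeMomentum (2 * k) (q - Q)) :=
      dispersion_latticeMomentum_pos (sub_ne_zero.2 hqQ)
    rw [← hε] at hAq
    have h := kls_heis_pointwise11 (K := -klsKernel (2 * k) κ b t q) hgq hE' hs hAq
    rw [hg]
    linarith
  have hsum := sum_le_sum hterm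
  rw [sum_neg_distrib, ← mul_sum] at hsum
  unfold klsKernelRiemannSum
  rw [← hQ]
  -- divide the combination by `|Λ|`
  have hgoal : klsKernel (2 * k) κ b t Q * (g Q / ((2 * k : ℕ) : ℝ) ^ 2) -
      Real.sqrt s * ((∑ q ∈ (univ : Finset (TorusSite 2 (2 * k))).erase Q,
        max (-klsKernel (2 * k) κ b t q) 0 *
          Real.sqrt (dispersion (latticeMomentum (2 * k) q) /
            dispersion (latticeMomentum (2 * k) (q - Q)))) / ((2 * k : ℕ) : ℝ) ^ 2) =
      (klsKernel (2 * k) κ b t Q * g Q - Real.sqrt s *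
        ∑ q ∈ (univ : Finset (TorusSite 2 (2 * k))).erase Q,
          max (-klsKernel (2 * k) κ b t q) 0 *
            Real.sqrt (dispersion (latticeMomentum (2 * k) q) /
              dispersion (latticeMomentum (2 * k) (q - Q)))) / ((2 * k : ℕ) : ℝ) ^ 2 := by
    field_simp
  have hgQ : g Q = heisStructureFactor 0 (2 * k) n Q := rfl
  rw [← hgQ, hgoal, div_le_iff₀ hL]
  have hfin : (Φ + b * ε + t * c) * ((2 * k : ℕ) : ℝ) ^ 2 =
      klsKernel (2 * k) κ b t Q * g Q +
        ∑ q ∈ (univ : Finset (TorusSite 2 (2 * k))).erase Q, g q * klsKernel (2 * k) κ b t q := by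
    rw [← hcomb]; ring
  rw [hfin]
  linarith [hsum]

/-- **Dropping the Néel term.** If `K(Q) ≥ 0` then, since `ĝ_Q ≥ 0` (`heisStructureFactor_nonneg`),
`b(-ε) - t S(S+1)/3 - (-ε/2)^{1/2} 𝓦_K(L) ≤ Φ_κ` on every square torus of even side `2k ≥ 4`.
[Kennedy–Lieb–Shastry 1988, eqs. (1)–(3), (6)–(9)] [cite: KLS1988JSP, eqs. (6)-(9)] -/
theorem kls_heis_kernelSumRule_drop (n k : ℕ) (hk : 2 ≤ k) [NeZero (2 * k)]
    (κ : TorusSite 2 (2 * k) → ℝ) {b t : ℝ} (hK : 0 ≤ klsKernel (2 * k) κ b t (neelIndex (2 * k))) :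
    b * (-heisBondCorr (d := 2) 0 (2 * k) n) - t * ((n : ℝ) / 2 * ((n : ℝ) / 2 + 1) / 3) -
        Real.sqrt (-heisBondCorr (d := 2) 0 (2 * k) n / 2) * klsKernelRiemannSum (2 * k) κ b t ≤
      klsKernelCorr (2 * k) n κ := by
  have hmain := kls_heis_kernelSumRule n k hk κ b t
  have hg : 0 ≤ heisStructureFactor 0 (2 * k) n (neelIndex (2 * k) : TorusSite 2 (2 * k)) /
      ((2 * k : ℕ) : ℝ) ^ 2 :=
    div_nonneg (heisStructureFactor_nonneg (2 * k) n _) (by positivity)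
  have hQ : 0 ≤ klsKernel (2 * k) κ b t (neelIndex (2 * k)) *
      (heisStructureFactor 0 (2 * k) n (neelIndex (2 * k) : TorusSite 2 (2 * k)) /
        ((2 * k : ℕ) : ℝ) ^ 2) := mul_nonneg hK hg
  linarith

/-- **The energy-free dictionary bound.** For `b > 0` and `K(Q) ≥ 0`, minimising the dropped bound over
the unknown `-ε ≥ 0` (arithmetic–geometric mean, `2b y² - y 𝓦 ≥ -𝓦²/(8b)` at `y = (-ε/2)^{1/2}`):
`-t S(S+1)/3 - 𝓦_K(L)²/(8b) ≤ Φ_κ = Σ_z κ(z) c(z)` for the spin-`n/2` antiferromagnet on every square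
torus of even side `2k ≥ 4` — no information on the ground-state energy is used.
[Kennedy–Lieb–Shastry 1988, eqs. (6)–(9) (with `e₀` eliminated)] [cite: KLS1988JSP, eqs. (6)-(9)] -/
theorem kls_heis_kernelCorr_lower_energyFree (n k : ℕ) (hk : 2 ≤ k) [NeZero (2 * k)]
    (κ : TorusSite 2 (2 * k) → ℝ) {b t : ℝ} (hb : 0 < b)
    (hK : 0 ≤ klsKernel (2 * k) κ b t (neelIndex (2 * k))) :
    -t * ((n : ℝ) / 2 * ((n : ℝ) / 2 + 1) / 3) - klsKernelRiemannSum (2 * k) κ b t ^ 2 / (8 * b) ≤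
      klsKernelCorr (2 * k) n κ := by
  have hmain := kls_heis_kernelSumRule_drop n k hk κ (b := b) (t := t) hK
  set u := -heisBondCorr (d := 2) 0 (2 * k) n with hu
  set W := klsKernelRiemannSum (2 * k) κ b t with hW
  have hN := heisBondCorr_le (d := 2) (by norm_num) n k hk
  have hu0 : 0 ≤ u / 2 := by
    rw [hu]
    have : 0 ≤ ((n : ℝ) / 2) ^ 2 / 3 := by positivity
    linarith
  set y := Real.sqrt (u / 2) with hy
  have hy2 : y ^ 2 = u / 2 := Real.sq_sqrt hu0
  have key : 2 * b * y ^ 2 - y * W + W ^ 2 / (8 * b) = (4 * b * y - W) ^ 2 / (8 * b) := by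
    field_simp
    ring
  have hpos : 0 ≤ (4 * b * y - W) ^ 2 / (8 * b) := by positivity
  have : b * u = 2 * b * y ^ 2 := by rw [hy2]; ring
  nlinarith [hmain, key, hpos, this]

/-- **Spin ½** (the form used by the HubbardLadder cell's dictionary devices): for every even side
`L = 2k ≥ 4`, every dictionary `κ` and all real `b > 0`, `t` with `K(Q) ≥ 0`,
`-t/4 - 𝓦_K(L)²/(8b) ≤ Σ_z κ(z) c_L(z)`, `c_L(z) = Re ω(S³_0 S³_z)`. [Kennedy–Lieb–Shastry 1988,
eqs. (6)–(9), p. 1023] [cite: KLS1988JSP, eqs. (6)-(9)] -/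
theorem kls_heis_kernelCorr_lower_energyFree_spinHalf (k : ℕ) (hk : 2 ≤ k) [NeZero (2 * k)]
    (κ : TorusSite 2 (2 * k) → ℝ) {b t : ℝ} (hb : 0 < b)
    (hK : 0 ≤ klsKernel (2 * k) κ b t (neelIndex (2 * k))) :
    -t / 4 - klsKernelRiemannSum (2 * k) κ b t ^ 2 / (8 * b) ≤ klsKernelCorr (2 * k) 1 κ := by
  have h := kls_heis_kernelCorr_lower_energyFree 1 k hk κ hb hK
  norm_num at h
  linarith

/-- **An upper bound on the Néel order parameter from a dictionary of correlations** (the retained form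
read the other way): if `K(Q) > 0` then
`|Λ|⁻¹ ĝ_Q ≤ (Φ_κ + b ε + t S(S+1)/3 + (-ε/2)^{1/2} 𝓦_K(L)) / K(Q)` on every square torus of even side
`2k ≥ 4`. [Kennedy–Lieb–Shastry 1988, eqs. (6)–(9)] [cite: KLS1988JSP, eqs. (6)-(9)] -/
theorem heis_neelParameter_le_of_kernel (n k : ℕ) (hk : 2 ≤ k) [NeZero (2 * k)]
    (κ : TorusSite 2 (2 * k) → ℝ) {b t : ℝ} (hK : 0 < klsKernel (2 * k) κ b t (neelIndex (2 * k))) :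
    heisStructureFactor 0 (2 * k) n (neelIndex (2 * k) : TorusSite 2 (2 * k)) / ((2 * k : ℕ) : ℝ) ^ 2 ≤
      (klsKernelCorr (2 * k) n κ + b * heisBondCorr (d := 2) 0 (2 * k) n +
          t * ((n : ℝ) / 2 * ((n : ℝ) / 2 + 1) / 3) +
        Real.sqrt (-heisBondCorr (d := 2) 0 (2 * k) n / 2) * klsKernelRiemannSum (2 * k) κ b t) /
        klsKernel (2 * k) κ b t (neelIndex (2 * k)) := by
  have hmain := kls_heis_kernelSumRule n k hk κ b t
  rw [le_div_iff₀ hK]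
  linarith

end Literature.MathematicalPhysics.QuantumLattice
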